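import Literature.Computability.AlgebraicComplexity.BI17FundamentalInvariantTensors
import HarnessLib

/-!
# Bürgisser–Ikenmeyer 2017, §5: `E(w) = E(m)` and `e(w) = e(m)` for almost all tensors `w` — discharge

P. Bürgisser, C. Ikenmeyer, *Fundamental invariants of orbit closures*, J. Algebra **477** (2017)
390–434 = arXiv:1511.02927 [BurgisserIkenmeyer2017], §5 after eq. (5.1) (`main.tex` L2012; held
text `paper:arxiv-1511.02927`, p0018): "It is easy to see that `E(w) = E(m)`, and hence
`e(w) = e(m)`, for almost all `w ∈ ⊗³ℂ^m`." Theorem-only companion of the file of record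
`BI17FundamentalInvariantTensors.lean` (val-lit row BI17-B, t04), which types the sentence as the
named fact `BI2017_tensorDegreeMonoid_generic` (Zariski-genericity as `IsZariskiGenericTensor`);
the tensor twin of `BI17GenericDegreeMonoidProofs.lean` (forms, `BI2017_degreeMonoid_generic`).

The (unprinted) argument formalized here: `E(m) ⊆ ℕ` is an additive submonoid
(`zero_mem_genericTensorDegreeMonoid`, `add_mem_genericTensorDegreeMonoid`: products of nonzero
homogeneous `SL³`-invariants), generated by its least positive element `e₀ = e(m)` together with the
least element of each residue class mod `e₀` meeting `E(m)` (every positive `d ∈ E(m)` is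
`m_{d mod e₀} + e₀ q`). Choosing a nonzero homogeneous invariant witness for each generator, their
product `Z ≠ 0` is the Zariski polynomial: if `Z(w) ≠ 0` then every generator's witness is nonzero
at the point `w = (1 ⊗ 1 ⊗ 1) w` of the orbit `Gw`, so products of witnesses show `E(m) ⊆ E(w)`; the
inclusion `E(w) ⊆ E(m)` is `tensorDegreeMonoid_subset_genericTensorDegreeMonoid`, and `e(w) = e(m)`
follows by rewriting. Everything holds over any field and any finite index type
(`isZariskiGenericTensor_degreeMonoid_eq`).

* `IsSL3Invariant.one/mul/pow` — the `SL³`-invariants form a submonoid of `k[⊗³]`.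
* `mem_tensorOrbitVanishingIdeal_iff`, `self_mem_tensorGLOrbit`,
  `tensorDegreeMonoid_subset_genericTensorDegreeMonoid`, `mem_tensorDegreeMonoid_of_aeval_ne_zero`,
  `zero_mem_tensorDegreeMonoid`, `zero_mem_genericTensorDegreeMonoid`,
  `add_mem_genericTensorDegreeMonoid` — tensor-side API parallel to the forms file.
* `isZariskiGenericTensor_degreeMonoid_eq` — the generic statement over any field.
* `BI2017_tensorDegreeMonoid_generic_holds` — **the fact DISCHARGED**.

No new definitions; no facts introduced. Honest framing: a statement about invariants of generic
tensors; nothing here bears on VP versus VNP.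

## References

* [BurgisserIkenmeyer2017] P. Bürgisser, C. Ikenmeyer, *Fundamental invariants of orbit closures*,
  J. Algebra 477 (2017) 390–434; arXiv:1511.02927, §5 Def. 5.2, eq. (5.1) and the sentence after it.
-/

open MvPolynomial

namespace Literature.Computability.AlgebraicComplexity

section SL3InvariantMonoid

variable {ι k : Type*} [Fintype ι] [DecidableEq ι] [Field k]

/-- `1 ∈ O(⊗³)^{SL³}`. [cite: BurgisserIkenmeyer2017, §5 (the invariant ring)] -/
theorem IsSL3Invariant.one : IsSL3Invariant (1 : MvPolynomial (ι × ι × ι) k) :=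
  fun g₁ g₂ g₃ w => by rw [map_one, map_one]

/-- `O(⊗³)^{SL³}` is closed under products. [cite: BurgisserIkenmeyer2017, §5 (the invariant ring)] -/
theorem IsSL3Invariant.mul {F G : MvPolynomial (ι × ι × ι) k} (hF : IsSL3Invariant F)
    (hG : IsSL3Invariant G) : IsSL3Invariant (F * G) := fun g₁ g₂ g₃ w => by
  rw [map_mul, map_mul, hF, hG]

/-- `O(⊗³)^{SL³}` is closed under powers. [cite: BurgisserIkenmeyer2017, §5 (the invariant ring)] -/
theorem IsSL3Invariant.pow {F : MvPolynomial (ι × ι × ι) k} (hF : IsSL3Invariant F) (n : ℕ) :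
    IsSL3Invariant (F ^ n) := fun g₁ g₂ g₃ w => by
  rw [map_pow, map_pow, hF]

/-- `0 ∈ E(m)`: the constant `1` is a nonzero invariant of degree `0`.
[cite: BurgisserIkenmeyer2017, §5 eq. (5.1)] -/
theorem zero_mem_genericTensorDegreeMonoid : 0 ∈ genericTensorDegreeMonoid ι k :=
  ⟨1, isHomogeneous_one _ _, IsSL3Invariant.one, one_ne_zero⟩

/-- `E(m)` is closed under addition (products of nonzero homogeneous invariants), so `E(m)` is a
submonoid of `(ℕ,+)` — the "monoid" of eq. (5.1). [cite: BurgisserIkenmeyer2017, §5 eq. (5.1)] -/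
theorem add_mem_genericTensorDegreeMonoid {d e : ℕ} (hd : d ∈ genericTensorDegreeMonoid ι k)
    (he : e ∈ genericTensorDegreeMonoid ι k) : d + e ∈ genericTensorDegreeMonoid ι k := by
  obtain ⟨F, hFh, hFi, hF0⟩ := hd
  obtain ⟨G, hGh, hGi, hG0⟩ := he
  exact ⟨F * G, hFh.mul hGh, hFi.mul hGi, mul_ne_zero hF0 hG0⟩

/-- Membership in `I(Gw)`: `F` vanishes at every point `(g₁ ⊗ g₂ ⊗ g₃) w` of the orbit.
[cite: BurgisserIkenmeyer2017, §5 (the orbit Gw)] -/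
theorem mem_tensorOrbitVanishingIdeal_iff {w : ι → ι → ι → k} {F : MvPolynomial (ι × ι × ι) k} :
    F ∈ tensorOrbitVanishingIdeal w ↔ ∀ g : GL ι k × GL ι k × GL ι k,
      aeval (tensorPt (actTensor (g.1 : Matrix ι ι k) (g.2.1 : Matrix ι ι k)
        (g.2.2 : Matrix ι ι k) w)) F = 0 := by
  rw [tensorOrbitVanishingIdeal, MvPolynomial.mem_vanishingIdeal_iff, Set.forall_mem_image]
  refine ⟨fun h g => h ⟨g, rfl⟩, fun h v hv => ?_⟩
  obtain ⟨g, rfl⟩ := hv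
  exact h g

/-- `w = (1 ⊗ 1 ⊗ 1) w ∈ Gw`. [cite: BurgisserIkenmeyer2017, §5 (the orbit Gw)] -/
theorem self_mem_tensorGLOrbit (w : ι → ι → ι → k) : w ∈ tensorGLOrbit w :=
  ⟨1, by simp only [Prod.fst_one, Prod.snd_one, Units.val_one, actTensor_one]⟩

/-- `E(w) ⊆ E(m)`: an invariant not vanishing on the orbit is nonzero (the tensor analogue of BI 2017,
proof of Thm. 3.15, L1147). [cite: BurgisserIkenmeyer2017, Def. 5.2 and eq. (5.1)] -/
theorem tensorDegreeMonoid_subset_genericTensorDegreeMonoid (w : ι → ι → ι → k) :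
    tensorDegreeMonoid w ⊆ genericTensorDegreeMonoid ι k := by
  rintro d ⟨F, hFh, hFi, hFI⟩
  refine ⟨F, hFh, hFi, fun hF0 => hFI ?_⟩
  rw [hF0]
  exact Ideal.zero_mem _

/-- A homogeneous `SL³`-invariant of degree `d` that is nonzero AT `w` (a point of its own orbit) does
not vanish on the orbit, so `d ∈ E(w)`. [cite: BurgisserIkenmeyer2017, Def. 5.2] -/
theorem mem_tensorDegreeMonoid_of_aeval_ne_zero {w : ι → ι → ι → k}
    {F : MvPolynomial (ι × ι × ι) k} {d : ℕ} (hFh : F.IsHomogeneous d) (hFi : IsSL3Invariant F)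
    (hF : aeval (tensorPt w) F ≠ 0) : d ∈ tensorDegreeMonoid w :=
  ⟨F, hFh, hFi, fun h => hF
    (MvPolynomial.mem_vanishingIdeal_iff.mp h (tensorPt w) ⟨w, self_mem_tensorGLOrbit w, rfl⟩)⟩

/-- `0 ∈ E(w)`: the constant `1` does not vanish on the orbit. [cite: BurgisserIkenmeyer2017, Def. 5.2] -/
theorem zero_mem_tensorDegreeMonoid (w : ι → ι → ι → k) : 0 ∈ tensorDegreeMonoid w :=
  mem_tensorDegreeMonoid_of_aeval_ne_zero (isHomogeneous_one _ _) IsSL3Invariant.one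
    (by rw [map_one]; exact one_ne_zero)

/-- The least element of a subclass of a set `S ⊆ ℕ` containing `0` lies in `S` (it is `0` when the
subclass is empty). [folklore] -/
private theorem sInf_sep_mem_tensor {S : Set ℕ} (h0 : 0 ∈ S) (p : ℕ → Prop) :
    sInf {a | a ∈ S ∧ p a} ∈ S := by
  by_cases hne : ({a | a ∈ S ∧ p a} : Set ℕ).Nonempty
  · exact (Nat.sInf_mem hne).1
  · rw [Set.not_nonempty_iff_eq_empty.mp hne, Nat.sInf_empty]
    exact h0

end SL3InvariantMonoid

section GenericTensorDegreeMonoid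

variable {ι k : Type*} [Fintype ι] [DecidableEq ι] [Field k]

/-- **`E(w) = E(m)` and `e(w) = e(m)` for Zariski-almost all tensors `w ∈ ⊗³k^ι`** (BI 2017, §5 after
eq. (5.1), L2012: "It is easy to see"), over any field and any finite index type.
Proof: `E(m)` is generated by `e₀ = e(m)` and the least elements `m_r` of the residue classes mod `e₀`
meeting it (every positive `d ∈ E(m)` is `m_{d mod e₀} + e₀ q`); the product `Z` of chosen nonzero
homogeneous invariant witnesses of these finitely many generators is nonzero, and `Z(w) ≠ 0` makes
every witness nonzero at `w ∈ Gw`, whence `E(m) ⊆ E(w)` by products of witnesses; the converse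
inclusion is `tensorDegreeMonoid_subset_genericTensorDegreeMonoid`.
[cite: BurgisserIkenmeyer2017, §5 (after eq. (5.1))] -/
theorem isZariskiGenericTensor_degreeMonoid_eq :
    IsZariskiGenericTensor fun w : ι → ι → ι → k =>
      tensorDegreeMonoid w = genericTensorDegreeMonoid ι k ∧
        tensorMinimalDegree w = genericTensorMinimalDegree ι k := by
  classical
  set S := genericTensorDegreeMonoid ι k with hS_def
  have h0S : (0 : ℕ) ∈ S := zero_mem_genericTensorDegreeMonoid
  -- a nonzero homogeneous invariant witness `wit d` for every `d ∈ E(m)`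
  have H : ∀ d ∈ S, ∃ F : MvPolynomial (ι × ι × ι) k,
      F.IsHomogeneous d ∧ IsSL3Invariant F ∧ F ≠ 0 := fun d h => h
  choose! wit hwh hwi hw0 using H
  -- generators: the least positive element `e₀` and the least element of each residue class mod `e₀`
  set e₀ := sInf {a | a ∈ S ∧ 0 < a} with he₀_def
  set mrep : ℕ → ℕ := fun r => sInf {a | a ∈ S ∧ a % e₀ = r} with hmrep_def
  have he₀S : e₀ ∈ S := sInf_sep_mem_tensor h0S _
  have hmS : ∀ r, mrep r ∈ S := fun r => sInf_sep_mem_tensor h0S _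
  refine ⟨wit e₀ * ∏ r ∈ Finset.range e₀, wit (mrep r),
    mul_ne_zero (hw0 _ he₀S) (Finset.prod_ne_zero_iff.mpr fun r _ => hw0 _ (hmS r)),
    fun w hZ => ?_⟩
  rw [map_mul, map_prod] at hZ
  have hZ0 : aeval (tensorPt w) (wit e₀) ≠ 0 := left_ne_zero_of_mul hZ
  have hZr : ∀ r ∈ Finset.range e₀, aeval (tensorPt w) (wit (mrep r)) ≠ 0 := fun r hr =>
    Finset.prod_ne_zero_iff.mp (right_ne_zero_of_mul hZ) r hr
  have hE : tensorDegreeMonoid w = S := by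
    refine Set.Subset.antisymm (tensorDegreeMonoid_subset_genericTensorDegreeMonoid w)
      fun d hdS => ?_
    rcases Nat.eq_zero_or_pos d with rfl | hd0
    · exact zero_mem_tensorDegreeMonoid w
    · have hpos : ({a | a ∈ S ∧ 0 < a} : Set ℕ).Nonempty := ⟨d, hdS, hd0⟩
      have he₀pos : 0 < e₀ := (Nat.sInf_mem hpos).2
      have hr : d % e₀ ∈ Finset.range e₀ := Finset.mem_range.mpr (Nat.mod_lt d he₀pos)
      have hT : ({a | a ∈ S ∧ a % e₀ = d % e₀} : Set ℕ).Nonempty := ⟨d, hdS, rfl⟩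
      have hm_mod : mrep (d % e₀) % e₀ = d % e₀ := (Nat.sInf_mem hT).2
      have hm_le : mrep (d % e₀) ≤ d := Nat.sInf_le ⟨hdS, rfl⟩
      obtain ⟨q, hq⟩ : e₀ ∣ d - mrep (d % e₀) :=
        Nat.dvd_of_mod_eq_zero (Nat.sub_mod_eq_zero_of_mod_eq hm_mod.symm)
      have hd_eq : d = mrep (d % e₀) + e₀ * q := by omega
      refine mem_tensorDegreeMonoid_of_aeval_ne_zero (F := wit (mrep (d % e₀)) * wit e₀ ^ q) ?_
        ((hwi _ (hmS _)).mul ((hwi _ he₀S).pow q)) ?_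
      · have hh := (hwh _ (hmS (d % e₀))).mul ((hwh _ he₀S).pow q)
        rwa [← hd_eq] at hh
      · rw [map_mul, map_pow]
        exact mul_ne_zero (hZr _ hr) (pow_ne_zero _ hZ0)
  refine ⟨hE, ?_⟩
  simp only [tensorMinimalDegree, genericTensorMinimalDegree, hE, hS_def]

/-- **BI 2017, "`E(w) = E(m)`, and hence `e(w) = e(m)`, for almost all `w ∈ ⊗³ℂ^m`" DISCHARGED**
(`isZariskiGenericTensor_degreeMonoid_eq` at `ι = Fin m`, `k = ℂ`).
[cite: BurgisserIkenmeyer2017, §5 (after eq. (5.1))] -/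
theorem BI2017_tensorDegreeMonoid_generic_holds : BI2017_tensorDegreeMonoid_generic := fun m =>
  isZariskiGenericTensor_degreeMonoid_eq (ι := Fin m) (k := ℂ)

end GenericTensorDegreeMonoid

end Literature.Computability.AlgebraicComplexity
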